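import Mathlib

/-!
# Route `FilamentSkeletonRss` · cruxes `TransverseReduction1AL` (stmt-NavierStokesRegularity-23297) / `TransverseReduction1AR` (stmt-23611) ·
# registered stub S2a-loc `WaistColumnGateLoc1A` — the m = 0 radial block AT AXIAL FREQUENCY `ν`: mass identities

Helper file (theorems only, def-free; `--supports stmt-NavierStokesRegularity-23297 --as helper`; hand leafhand-ns-filamentskeletonrs-13 g0).

WHY.  By `Theorems/…AxialNeutralModes.lean` (p827006) the axial operator `κτ∂_τ − ∂_τ²` of the frozen waist column has every `iν` in its
approximate point spectrum, so the sectional bricks of S2a-loc are needed for the sectional operator SHIFTED BY `iν`, uniformly in `ν ∈ ℝ`.  For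
the m = 0 radial block (`radialBlock_apriori`, `Theorems/…RadialBlock.lean`, LEAD 21221-p1 g11: variable `u = r²`, flux `Φ = 4u w′ + γu w`,
`Φ′ = f` at `ν = 0`) the shifted block is the REAL SYSTEM for `w = a + ib`:
`(4u a′ + γu a)′ = f₁ − ν b`,  `(4u b′ + γu b)′ = f₂ + ν a`  on `(0, ∞)`
(LEAD sign convention: `f` is minus the operator datum).  This file records the first structural facts of the shifted block:

* `deriv_eq_zero_of_support_Ici` — a profile vanishing on `[U, ∞)` with a derivative continuous on `[0, ∞)` has vanishing derivative on `[U, ∞)`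
  (including the endpoint), so both fluxes vanish at `u = U` as well as at `u = 0`;
* **`radialBlockShift_mass`** — integrating the two flux equations over `[0, U]`: `ν·∫₀^U b = ∫₀^U f₁` and `ν·∫₀^U a = −∫₀^U f₂`.  So for `ν ≠ 0`
  the ZERO-MASS property of `w` (the hypothesis `hmass` of `radialBlock_apriori`, which at `ν = 0` is an independent solvability condition removing
  the `e^{γU/4}` kernel amplification) is AUTOMATIC from zero-mass data (`radialBlockShift_zeroMass`), and conversely admissible data must have
  zero mass.  (Reading, see the hand's memo S2ALOC-AXIAL-ANALYSIS §5b: the `ν`-uniform a-priori bound `(1+u)²|w| ≤ C(γ)M` is the whole-plane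
  resolvent `(A + iν)^{-1} = ∫₀^∞ e^{−iνt}e^{−tA}dt` on zero-mass data; it is NOT proved here.)
HONEST FRAMING: elementary one-variable analysis about ONE block of ONE linear MODEL operator of a hypothetical filament-type blow-up route (MODEL
rung, negative side); `WaistColumnGateLoc1A`, `TransverseReduction1AL/1AR` are neither proved nor refuted; nothing here bears on Navier–Stokes regularity.
-/

set_option linter.dupNamespace false

noncomputable section

namespace Summit.NavierStokesRegularity.NavierStokesRegularity.Theorems.DefectColumnGate

open scoped Topology
open Set Filter MeasureTheory intervalIntegral

/-! ## 1. Support bookkeeping -/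

/-- A profile vanishing on `[U, ∞)` (`0 < U`), differentiable on `(0, ∞)` with derivative `w₁` continuous on `[0, ∞)`, has `w₁ = 0` on `[U, ∞)`
(strictly beyond `U` by uniqueness of the derivative of a locally vanishing function; at `U` by continuity from the right). -/
theorem deriv_eq_zero_of_support_Ici {U : ℝ} {w w₁ : ℝ → ℝ} (hU : 0 < U) (hw₁ : ContinuousOn w₁ (Ici 0))
    (hder : ∀ u, 0 < u → HasDerivAt w (w₁ u) u) (hsupp : ∀ u, U ≤ u → w u = 0) :
    ∀ u, U ≤ u → w₁ u = 0 := by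
  have hzero : ∀ u, U < u → w₁ u = 0 := by
    intro u hu
    have hev : (fun _ : ℝ => (0:ℝ)) =ᶠ[𝓝 u] w := by
      have : Ioi U ∈ 𝓝 u := Ioi_mem_nhds hu
      filter_upwards [this] with s hs
      exact (hsupp s (le_of_lt hs)).symm
    have h0 : HasDerivAt w 0 u := (hasDerivAt_const u (0:ℝ)).congr_of_eventuallyEq hev.symm
    exact (hder u (hU.trans hu)).unique h0
  intro u hu
  rcases lt_or_eq_of_le hu with hlt | heq
  · exact hzero u hlt
  · subst heq
    have h1 : Tendsto w₁ (𝓝[>] U) (𝓝 (w₁ U)) :=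
      ((hw₁ U (show (0:ℝ) ≤ U from hU.le)).mono (fun x hx => le_trans hU.le (le_of_lt hx))).tendsto
    have h2 : Tendsto (fun _ : ℝ => (0:ℝ)) (𝓝[>] U) (𝓝 0) := tendsto_const_nhds
    have hev : w₁ =ᶠ[𝓝[>] U] fun _ => (0:ℝ) := eventually_nhdsWithin_of_forall fun x hx => hzero x hx
    exact tendsto_nhds_unique_of_eventuallyEq h1 h2 hev

/-! ## 2. The mass identities of the shifted radial block -/

/-- **Mass identities at axial frequency `ν`.**  For the shifted m = 0 block `(4u a′ + γu a)′ = f₁ − ν b`, `(4u b′ + γu b)′ = f₂ + ν a` on `(0,∞)`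
with `a, b` (and their derivatives `a₁, b₁`, and the data) continuous on `[0, ∞)` and `a = b = 0` on `[U, ∞)`:
`ν·∫₀^U b = ∫₀^U f₁` and `ν·∫₀^U a = −∫₀^U f₂` (both fluxes vanish at `0` and at `U`). -/
theorem radialBlockShift_mass {γ ν U : ℝ} {a b a₁ b₁ f₁ f₂ : ℝ → ℝ} (hU : 0 < U)
    (ha : ContinuousOn a (Ici 0)) (ha₁ : ContinuousOn a₁ (Ici 0)) (hb : ContinuousOn b (Ici 0)) (hb₁ : ContinuousOn b₁ (Ici 0))
    (hf₁ : ContinuousOn f₁ (Ici 0)) (hf₂ : ContinuousOn f₂ (Ici 0))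
    (hdera : ∀ u, 0 < u → HasDerivAt a (a₁ u) u) (hderb : ∀ u, 0 < u → HasDerivAt b (b₁ u) u)
    (hΦa : ∀ u, 0 < u → HasDerivAt (fun s => 4 * s * a₁ s + γ * s * a s) (f₁ u - ν * b u) u)
    (hΦb : ∀ u, 0 < u → HasDerivAt (fun s => 4 * s * b₁ s + γ * s * b s) (f₂ u + ν * a u) u)
    (hsuppa : ∀ u, U ≤ u → a u = 0) (hsuppb : ∀ u, U ≤ u → b u = 0) :
    (ν * ∫ u in (0:ℝ)..U, b u = ∫ u in (0:ℝ)..U, f₁ u) ∧ (ν * ∫ u in (0:ℝ)..U, a u = -∫ u in (0:ℝ)..U, f₂ u) := by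
  have hIcc : Icc (0:ℝ) U ⊆ Ici 0 := fun x hx => hx.1
  have huIcc : uIcc (0:ℝ) U = Icc 0 U := uIcc_of_le hU.le
  -- the fluxes vanish at both ends
  have ha₁U : a₁ U = 0 := deriv_eq_zero_of_support_Ici hU ha₁ hdera hsuppa U le_rfl
  have hb₁U : b₁ U = 0 := deriv_eq_zero_of_support_Ici hU hb₁ hderb hsuppb U le_rfl
  -- continuity of the fluxes on `[0, U]`
  have hlin : ContinuousOn (fun s : ℝ => s) (Icc (0:ℝ) U) := continuousOn_id
  have hΦac : ContinuousOn (fun s => 4 * s * a₁ s + γ * s * a s) (Icc 0 U) :=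
    ((continuousOn_const.mul hlin).mul (ha₁.mono hIcc)).add ((continuousOn_const.mul hlin).mul (ha.mono hIcc))
  have hΦbc : ContinuousOn (fun s => 4 * s * b₁ s + γ * s * b s) (Icc 0 U) :=
    ((continuousOn_const.mul hlin).mul (hb₁.mono hIcc)).add ((continuousOn_const.mul hlin).mul (hb.mono hIcc))
  -- integrability of the right-hand sides
  have hia : IntervalIntegrable (fun u => f₁ u - ν * b u) volume 0 U := by
    refine ContinuousOn.intervalIntegrable ?_
    rw [huIcc]
    exact (hf₁.mono hIcc).sub (continuousOn_const.mul (hb.mono hIcc))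
  have hib : IntervalIntegrable (fun u => f₂ u + ν * a u) volume 0 U := by
    refine ContinuousOn.intervalIntegrable ?_
    rw [huIcc]
    exact (hf₂.mono hIcc).add (continuousOn_const.mul (ha.mono hIcc))
  have hif₁ : IntervalIntegrable f₁ volume 0 U := by
    refine ContinuousOn.intervalIntegrable ?_; rw [huIcc]; exact hf₁.mono hIcc
  have hif₂ : IntervalIntegrable f₂ volume 0 U := by
    refine ContinuousOn.intervalIntegrable ?_; rw [huIcc]; exact hf₂.mono hIcc
  have hiav : IntervalIntegrable a volume 0 U := by
    refine ContinuousOn.intervalIntegrable ?_; rw [huIcc]; exact ha.mono hIcc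
  have hibv : IntervalIntegrable b volume 0 U := by
    refine ContinuousOn.intervalIntegrable ?_; rw [huIcc]; exact hb.mono hIcc
  -- fundamental theorem of calculus on `[0, U]`
  have hFTCa : ∫ u in (0:ℝ)..U, (f₁ u - ν * b u) = 0 := by
    rw [integral_eq_sub_of_hasDerivAt_of_le hU.le hΦac (fun x hx => hΦa x hx.1) hia]
    simp [ha₁U, hsuppa U le_rfl]
  have hFTCb : ∫ u in (0:ℝ)..U, (f₂ u + ν * a u) = 0 := by
    rw [integral_eq_sub_of_hasDerivAt_of_le hU.le hΦbc (fun x hx => hΦb x hx.1) hib]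
    simp [hb₁U, hsuppb U le_rfl]
  rw [intervalIntegral.integral_sub hif₁ (hibv.const_mul ν), intervalIntegral.integral_const_mul] at hFTCa
  rw [intervalIntegral.integral_add hif₂ (hiav.const_mul ν), intervalIntegral.integral_const_mul] at hFTCb
  constructor
  · linarith
  · linarith

/-- **Zero mass is automatic for `ν ≠ 0`.**  If the data have zero sectional mass (`∫₀^U f₁ = ∫₀^U f₂ = 0`) and `ν ≠ 0`, then `∫₀^U a = ∫₀^U b = 0`. -/
theorem radialBlockShift_zeroMass {γ ν U : ℝ} {a b a₁ b₁ f₁ f₂ : ℝ → ℝ} (hU : 0 < U) (hν : ν ≠ 0)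
    (ha : ContinuousOn a (Ici 0)) (ha₁ : ContinuousOn a₁ (Ici 0)) (hb : ContinuousOn b (Ici 0)) (hb₁ : ContinuousOn b₁ (Ici 0))
    (hf₁ : ContinuousOn f₁ (Ici 0)) (hf₂ : ContinuousOn f₂ (Ici 0))
    (hdera : ∀ u, 0 < u → HasDerivAt a (a₁ u) u) (hderb : ∀ u, 0 < u → HasDerivAt b (b₁ u) u)
    (hΦa : ∀ u, 0 < u → HasDerivAt (fun s => 4 * s * a₁ s + γ * s * a s) (f₁ u - ν * b u) u)
    (hΦb : ∀ u, 0 < u → HasDerivAt (fun s => 4 * s * b₁ s + γ * s * b s) (f₂ u + ν * a u) u)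
    (hsuppa : ∀ u, U ≤ u → a u = 0) (hsuppb : ∀ u, U ≤ u → b u = 0)
    (hmf₁ : ∫ u in (0:ℝ)..U, f₁ u = 0) (hmf₂ : ∫ u in (0:ℝ)..U, f₂ u = 0) :
    (∫ u in (0:ℝ)..U, a u = 0) ∧ (∫ u in (0:ℝ)..U, b u = 0) := by
  obtain ⟨h1, h2⟩ := radialBlockShift_mass hU ha ha₁ hb hb₁ hf₁ hf₂ hdera hderb hΦa hΦb hsuppa hsuppb
  rw [hmf₁] at h1
  rw [hmf₂, neg_zero] at h2
  exact ⟨(mul_eq_zero.mp h2).resolve_left hν, (mul_eq_zero.mp h1).resolve_left hν⟩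

end Summit.NavierStokesRegularity.NavierStokesRegularity.Theorems.DefectColumnGate

end
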